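import Mathlib
import Summits.Ventures.PercRepro2.Harris
import Summits.Ventures.PercRepro2.BasePrime
import Summits.Ventures.PercRepro2.LocRows
import Summits.Ventures.PercRepro2.SwRow
import Summits.Ventures.PercRepro2.SwOut
import Summits.Ventures.PercRepro2.SwAllRow
import Summits.Ventures.PercRepro2.SwOutAll
import Summits.Ventures.PercRepro2.SwOutCube
import Summits.Ventures.PercRepro2.SwOutArmFlip
import Summits.Ventures.PercRepro2.SwOutArms
import Summits.Ventures.PercRepro2.SwOutArmOrbit
import Summits.Ventures.PercRepro2.SwOutArmCube

/-!
# THE ARM PRINCIPLE (blind cell PercRepro2, night-4 g10, 2026-08-25; proofs/NIGHT4-G10.md §7)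

The core-free part of every outside class — the configurations whose red and blue clusters of `h`
meet only in `h` — satisfies the rigid counting inequality of (HLC), for every region `U ∋ h` with
`l ∉ U` and no loop at `h`, and every outside colouring: the core-free part is the disjoint union of
the orbits of the arm flips (the fibres of the all-red orientation `allRed`), and every orbit is a
cube on which Harris applies (`card_orbit_le`).

* `arms_eq_of_hull_eq`, `arm_subset_side`, `allRed_idem`, `allRed_orbitReal`,
  `exists_orbitReal_eq`: the fibres of `allRed` on the core-free part are the orbits;
* **`card_coreFree_le`**: the rigid counting inequality on the core-free part of the class;
* **`rigidOK_of_coreFree`**: a class all of whose `Q`-configurations are core-free satisfies the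
  rigid inequality (for every up-set);
* `coreFree_of_outEdges`: when every vertex of `U ∖ {h, o}` has an edge to the outside, every
  `Q`-configuration is core-free (a core vertex carries no outside edge; a core at `o` kills `Q`);
* **`swAll_of_outEdges`**, **`sw_of_outEdges`**: rows 2′SW-ALL and (SW) on every graph in which every
  vertex other than `l, h, o` is joined to `l` and `h` carries no loop — the complete graphs among
  them.
-/

namespace Summit.Ventures.PercRepro2

namespace LocRows

open Hull

variable {V : Type*} {E : Type*} [Fintype E] [DecidableEq E]

open scoped Classical

variable {ends : E → Sym2 V}

section Fibres

variable {ζ : Config E} {h : V}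

omit [DecidableEq E] in
/-- The arms only depend on the hull. -/
lemma arms_eq_of_hull_eq {ζ' : Config E} (hh : hull ends ζ' h = hull ends ζ h) :
    arms ends ζ' h = arms ends ζ h := by
  have h0 : armConfig ends ζ' h = armConfig ends ζ h := by
    funext e
    simp only [armConfig, hh]
  have h1 : armOfEdge ends ζ' h = armOfEdge ends ζ h := by
    funext e
    simp only [armOfEdge, arm, h0]
  simp only [arms, starEdges, hh, h1]

omit [Fintype E] [DecidableEq E] in
/-- An arm of a core-free configuration lies on one side. -/
lemma arm_subset_side (hc : CoreFree ends ζ h) {x : V} (hx : x ∈ hull ends ζ h) (hxh : x ≠ h) :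
    arm ends ζ h x ⊆ cluster ends ζ h ∨ arm ends ζ h x ⊆ cluster ends (blue ζ) h := by
  rcases hx with hxT | hxTp
  · left
    intro v hv
    refine (mem_of_conn_of_closed (ends := ends) (ω := armConfig ends ζ h)
      (S := {v | v ∈ cluster ends ζ h ∧ v ≠ h}) ?_ ⟨hxT, hxh⟩ hv).1
    intro a ha b hab
    obtain ⟨_, e, he, hends⟩ := openGraph_adj.1 hab
    obtain ⟨x', hx', y', hy', h'⟩ := armConfig_eq_true_iff.1 he
    have hbH : b ∈ hull ends ζ h ∧ b ≠ h := by
      rw [hends, Sym2.eq_iff] at h'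
      rcases h' with ⟨rfl, rfl⟩ | ⟨rfl, rfl⟩
      · exact hy'
      · exact hx'
    refine ⟨?_, hbH.2⟩
    rcases hbH.1 with hbT | hbTp
    · exact hbT
    · exact absurd (no_edge_sides_of_coreFree hc hends ha.1 ha.2 hbTp hbH.2) id
  · right
    intro v hv
    refine (mem_of_conn_of_closed (ends := ends) (ω := armConfig ends ζ h)
      (S := {v | v ∈ cluster ends (blue ζ) h ∧ v ≠ h}) ?_ ⟨hxTp, hxh⟩ hv).1
    intro a ha b hab
    obtain ⟨_, e, he, hends⟩ := openGraph_adj.1 hab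
    obtain ⟨x', hx', y', hy', h'⟩ := armConfig_eq_true_iff.1 he
    have hbH : b ∈ hull ends ζ h ∧ b ≠ h := by
      rw [hends, Sym2.eq_iff] at h'
      rcases h' with ⟨rfl, rfl⟩ | ⟨rfl, rfl⟩
      · exact hy'
      · exact hx'
    refine ⟨?_, hbH.2⟩
    rcases hbH.1 with hbT | hbTp
    · exact absurd (no_edge_sides_of_coreFree hc (ends_swap hends) hbT hbH.2 ha.1 ha.2) id
    · exact hbTp

omit [DecidableEq E] in
/-- Every arm of a core-free configuration lies on one side. -/
lemma arms_subset_side (hc : CoreFree ends ζ h) {P : Set V} (hP : P ∈ arms ends ζ h) :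
    P ⊆ cluster ends ζ h ∨ P ⊆ cluster ends (blue ζ) h := by
  simp only [arms, Finset.mem_image] at hP
  obtain ⟨e, he, rfl⟩ := hP
  obtain ⟨y, _, hyh, hyH, hPy⟩ := armOfEdge_eq_arm he
  rw [hPy]
  exact arm_subset_side hc hyH hyh

omit [Fintype E] [DecidableEq E] in
/-- Flipping the empty set does nothing. -/
lemma flip_empty (ζ : Config E) : flip ends (∅ : Set V) ζ = ζ := by
  funext e
  rw [flip_apply_of_notMem]
  rintro ⟨x, hx, _, _⟩
  exact hx

omit [Fintype E] [DecidableEq E] in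
/-- The all-red orientation is idempotent. -/
lemma allRed_idem (hc : CoreFree ends ζ h) : allRed ends (allRed ends ζ h) h = allRed ends ζ h := by
  show flip ends (cluster ends (blue (allRed ends ζ h)) h \ {h}) (allRed ends ζ h) = allRed ends ζ h
  rw [cluster_blue_allRed hc, Set.sdiff_self, flip_empty]

omit [DecidableEq E] in
/-- The all-red orientation of a realisation is the all-red orientation of the base. -/
lemma allRed_orbitReal (hc : CoreFree ends ζ h) (ω : Config (arms ends ζ h)) :
    allRed ends (orbitReal ends ζ h ω) h = allRed ends ζ h := by
  show flip ends (cluster ends (blue (orbitReal ends ζ h ω)) h \ {h}) (orbitReal ends ζ h ω) =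
    allRed ends ζ h
  rw [cluster_blue_orbitReal hc]
  have : insert h (armsFalse ends ζ h ω) \ {h} = armsFalse ends ζ h ω := by
    ext x
    simp only [Set.mem_sdiff, Set.mem_insert_iff, Set.mem_singleton_iff]
    constructor
    · rintro ⟨rfl | hx, hxh⟩
      · exact absurd rfl hxh
      · exact hx
    · exact fun hx => ⟨Or.inr hx, (mem_hull_sdiff_of_mem_armsFalse hx).2⟩
  rw [this]
  unfold orbitReal
  rw [Hull.flip_flip]

omit [DecidableEq E] in
/-- **Every core-free configuration with all-red orientation `ζ₀` is a realisation over `ζ₀`.** -/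
theorem exists_orbitReal_eq {ζ₀ ζ' : Config E} (hc' : CoreFree ends ζ' h)
    (hζ₀ : allRed ends ζ' h = ζ₀) :
    ∃ ω : Config (arms ends ζ₀ h), orbitReal ends ζ₀ h ω = ζ' := by
  have hc₀ : CoreFree ends ζ₀ h := hζ₀ ▸ coreFree_allRed hc'
  have hhull : hull ends ζ₀ h = hull ends ζ' h := hζ₀ ▸ hull_allRed hc'
  have harms : arms ends ζ₀ h = arms ends ζ' h := arms_eq_of_hull_eq hhull
  -- the cube point: an arm is `true` when it is red in `ζ'`
  refine ⟨fun P => decide (P.1 ⊆ cluster ends ζ' h), ?_⟩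
  have h1 : allRed ends ζ₀ h = ζ₀ := by rw [← hζ₀]; exact allRed_idem hc'
  -- the arms assigned `false` are exactly the blue side minus `h`
  have key : armsFalse ends ζ₀ h (fun P => decide (P.1 ⊆ cluster ends ζ' h)) =
      cluster ends (blue ζ') h \ {h} := by
    ext x
    constructor
    · rintro ⟨P, hP, hxP⟩
      have hP' : P.1 ∈ arms ends ζ' h := harms ▸ P.2
      simp only [decide_eq_false_iff_not] at hP
      rcases arms_subset_side hc' hP' with hred | hblue
      · exact absurd hred hP
      · exact ⟨hblue hxP, (mem_hull_sdiff_of_mem_arms hP' hxP).2⟩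
    · rintro ⟨hxTp, hxh⟩
      have hxh' : x ≠ h := hxh
      obtain ⟨P, hP, hxP⟩ := exists_mem_arms (ζ := ζ') (Or.inr hxTp) hxh'
      refine ⟨⟨P, harms ▸ hP⟩, ?_, hxP⟩
      simp only [decide_eq_false_iff_not]
      intro hred
      exact hxh' (hc' x (hred hxP) hxTp)
  unfold orbitReal
  rw [h1, key, ← hζ₀]
  unfold allRed
  exact Hull.flip_flip _ _

end Fibres

section Sum

variable {U : Set V} {ξ : Config E} {l h o : V}

/-- The core-free part of the class. -/
noncomputable def coreFreePart (ends : E → Sym2 V) (l h o : V) (U : Set V) (ξ : Config E) :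
    Finset (Config E) :=
  (swOutSide ends l h o U ξ).filter fun ζ => CoreFree ends ζ h

/-- **THE ARM PRINCIPLE**: the core-free part of every class satisfies the rigid counting
inequality (no loop at `h`). -/
theorem card_coreFree_le (hl : l ∉ U) (hloop : ∀ e, ends e ≠ s(h, h)) {𝓔 : Set (Set E)}
    (h𝓔 : IsUpperSet 𝓔) :
    ((coreFreePart ends l h o U ξ).filter fun ζ => redEdges ends ζ h ∈ 𝓔).card ≤
      ((coreFreePart ends l h o U ξ).filter fun ζ => blueEdges ends ζ h ∈ 𝓔).card := by
  -- split both sides by the fibres of `allRed`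
  let can : Config E → Config E := fun ζ => allRed ends ζ h
  let S₀ : Finset (Config E) := (coreFreePart ends l h o U ξ).image can
  have hmapR : ∀ ζ ∈ (coreFreePart ends l h o U ξ).filter fun ζ => redEdges ends ζ h ∈ 𝓔,
      can ζ ∈ S₀ := fun ζ hζ => Finset.mem_image_of_mem can (Finset.mem_filter.1 hζ).1
  have hmapB : ∀ ζ ∈ (coreFreePart ends l h o U ξ).filter fun ζ => blueEdges ends ζ h ∈ 𝓔,
      can ζ ∈ S₀ := fun ζ hζ => Finset.mem_image_of_mem can (Finset.mem_filter.1 hζ).1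
  rw [Finset.card_eq_sum_card_fiberwise hmapR, Finset.card_eq_sum_card_fiberwise hmapB]
  refine Finset.sum_le_sum fun ζ₀ hζ₀ => ?_
  -- `ζ₀` is the all-red orientation of a core-free class configuration
  obtain ⟨ζ₁, hζ₁, rfl⟩ := Finset.mem_image.1 hζ₀
  have hζ₁' := Finset.mem_filter.1 hζ₁
  have hc₁ : CoreFree ends ζ₁ h := hζ₁'.2
  have hcl₁ : ζ₁ ∈ outClass ends U h ξ := (mem_swOutSide.1 hζ₁'.1).2
  have hc₀ : CoreFree ends (allRed ends ζ₁ h) h := coreFree_allRed hc₁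
  have hcl₀ : allRed ends ζ₁ h ∈ outClass ends U h ξ := allRed_mem_outClass hcl₁ hc₁
  -- the fibre is the orbit intersected with `Q`
  have hfib : ∀ P : Config E → Prop,
      ((coreFreePart ends l h o U ξ).filter fun ζ => P ζ).filter (fun ζ => can ζ = can ζ₁) =
        (orbit ends (allRed ends ζ₁ h) h).filter fun ζ' =>
          ζ' ∈ tgtU ends l h {S : Set V | o ∈ S} ∧ P ζ' := by
    intro P
    ext ζ'
    simp only [Finset.mem_filter, coreFreePart, orbit, Finset.mem_image, Finset.mem_univ, true_and,
      mem_swOutSide, can]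
    constructor
    · rintro ⟨⟨⟨⟨hQ, _⟩, hc'⟩, hP⟩, hcan⟩
      obtain ⟨ω, hω⟩ := exists_orbitReal_eq hc' hcan
      exact ⟨⟨ω, hω⟩, hQ, hP⟩
    · rintro ⟨⟨ω, rfl⟩, hQ, hP⟩
      refine ⟨⟨⟨⟨hQ, orbitReal_mem_outClass hc₀ hcl₀ ω⟩, coreFree_orbitReal hc₀ ω⟩, hP⟩, ?_⟩
      rw [allRed_orbitReal hc₀ ω, allRed_idem hc₁]
  rw [hfib, hfib]
  exact card_orbit_le hc₀ hloop hcl₀ hl h𝓔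

/-- **A class all of whose `Q`-configurations are core-free satisfies the rigid inequality.** -/
theorem rigidOK_of_coreFree (hl : l ∉ U) (hloop : ∀ e, ends e ≠ s(h, h))
    (hcf : ∀ ζ ∈ swOutSide ends l h o U ξ, CoreFree ends ζ h) {𝓔 : Set (Set E)}
    (h𝓔 : IsUpperSet 𝓔) :
    ((swOutSide ends l h o U ξ).filter fun ζ => redEdges ends ζ h ∈ 𝓔).card ≤
      ((swOutSide ends l h o U ξ).filter fun ζ => blueEdges ends ζ h ∈ 𝓔).card := by
  have heq : coreFreePart ends l h o U ξ = swOutSide ends l h o U ξ := by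
    ext ζ
    simp only [coreFreePart, Finset.mem_filter]
    exact ⟨fun h' => h'.1, fun h' => ⟨h', hcf ζ h'⟩⟩
  have := card_coreFree_le (ends := ends) (ξ := ξ) (o := o) hl hloop h𝓔
  rw [heq] at this
  exact this

/-- When every vertex of `U ∖ {h, o}` has an edge to the outside, every `Q`-configuration of the
class is core-free: a core vertex carries no outside edge, and a core at `o` kills `o ∈ C_R(l)`. -/
theorem coreFree_of_outEdges
    (hout : ∀ x ∈ U, x ≠ h → x ≠ o → ∃ e y, ends e = s(x, y) ∧ y ∉ U) {ζ : Config E}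
    (hζ : ζ ∈ swOutSide ends l h o U ξ) : CoreFree ends ζ h := by
  intro x hxT hxTp
  by_contra hxh
  have hQ := (mem_swOutSide.1 hζ).1
  have hcl := (mem_swOutSide.1 hζ).2
  simp only [tgtU, Finset.mem_filter, Finset.mem_univ, true_and, Set.mem_setOf_eq, hull,
    Set.mem_union, not_or] at hQ
  obtain ⟨⟨hhA, _⟩, hoA, _⟩ := hQ
  have hxU : x ∈ U := (mem_outClass.1 hcl).2 (Or.inl hxT)
  by_cases hxo : x = o
  · -- `o ∈ C_R(h) ∩ C_R(l)` joins `h` to `l`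
    subst hxo
    exact hhA (conn_trans hoA (conn_symm hxT))
  · obtain ⟨e, y, hxy, hyU⟩ := hout x hxU hxh hxo
    cases he : ζ e with
    | true => exact hyU ((mem_outClass.1 hcl).2 (Or.inl (mem_cluster_of_edge hxT he hxy)))
    | false =>
      have he' : blue ζ e = true := by rw [blue_eq_true_iff]; exact he
      exact hyU ((mem_outClass.1 hcl).2 (Or.inr (mem_cluster_of_edge hxTp he' hxy)))

/-- **The rigid inequality on every class of a region whose non-mark vertices all carry an outside
edge** (no loop at `h`). -/
theorem rigidOK_of_outEdges (hl : l ∉ U) (hloop : ∀ e, ends e ≠ s(h, h))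
    (hout : ∀ x ∈ U, x ≠ h → x ≠ o → ∃ e y, ends e = s(x, y) ∧ y ∉ U) {𝓔 : Set (Set E)}
    (h𝓔 : IsUpperSet 𝓔) :
    ((swOutSide ends l h o U ξ).filter fun ζ => redEdges ends ζ h ∈ 𝓔).card ≤
      ((swOutSide ends l h o U ξ).filter fun ζ => blueEdges ends ζ h ∈ 𝓔).card :=
  rigidOK_of_coreFree hl hloop (fun _ hζ => coreFree_of_outEdges hout hζ) h𝓔

omit [Fintype E] [DecidableEq E] in
/-- A vertex of a cluster of `h` other than `h` carries an edge. -/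
lemma exists_edge_of_mem_cluster {ζ : Config E} {x : V} (hx : x ∈ cluster ends ζ h) (hxh : x ≠ h) :
    ∃ e, x ∈ ends e := by
  rw [cluster_eq_insert_ends_redEdges] at hx
  rcases hx with rfl | ⟨e, _, hxe⟩
  · exact absurd rfl hxh
  · exact ⟨e, hxe⟩

/-- When every vertex of `U ∖ {h, o}` has an outside edge or no edge at all, every
`Q`-configuration of the class is core-free. -/
theorem coreFree_of_outEdges' (hout : ∀ x ∈ U, x ≠ h → x ≠ o →
      (∃ e y, ends e = s(x, y) ∧ y ∉ U) ∨ (∀ e, x ∉ ends e)) {ζ : Config E}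
    (hζ : ζ ∈ swOutSide ends l h o U ξ) : CoreFree ends ζ h := by
  intro x hxT hxTp
  by_contra hxh
  have hQ := (mem_swOutSide.1 hζ).1
  have hcl := (mem_swOutSide.1 hζ).2
  simp only [tgtU, Finset.mem_filter, Finset.mem_univ, true_and, Set.mem_setOf_eq, hull,
    Set.mem_union, not_or] at hQ
  obtain ⟨⟨hhA, _⟩, hoA, _⟩ := hQ
  have hxU : x ∈ U := (mem_outClass.1 hcl).2 (Or.inl hxT)
  by_cases hxo : x = o
  · subst hxo
    exact hhA (conn_trans hoA (conn_symm hxT))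
  · rcases hout x hxU hxh hxo with ⟨e, y, hxy, hyU⟩ | hiso
    · cases he : ζ e with
      | true => exact hyU ((mem_outClass.1 hcl).2 (Or.inl (mem_cluster_of_edge hxT he hxy)))
      | false =>
        have he' : blue ζ e = true := by rw [blue_eq_true_iff]; exact he
        exact hyU ((mem_outClass.1 hcl).2 (Or.inr (mem_cluster_of_edge hxTp he' hxy)))
    · obtain ⟨e, hxe⟩ := exists_edge_of_mem_cluster hxT hxh
      exact hiso e hxe

/-- **The rigid inequality on every class of a region whose non-mark vertices carry an outside
edge or no edge at all** (no loop at `h`). -/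
theorem rigidOK_of_outEdges' (hl : l ∉ U) (hloop : ∀ e, ends e ≠ s(h, h))
    (hout : ∀ x ∈ U, x ≠ h → x ≠ o → (∃ e y, ends e = s(x, y) ∧ y ∉ U) ∨ (∀ e, x ∉ ends e))
    {𝓔 : Set (Set E)} (h𝓔 : IsUpperSet 𝓔) :
    ((swOutSide ends l h o U ξ).filter fun ζ => redEdges ends ζ h ∈ 𝓔).card ≤
      ((swOutSide ends l h o U ξ).filter fun ζ => blueEdges ends ζ h ∈ 𝓔).card :=
  rigidOK_of_coreFree hl hloop (fun _ hζ => coreFree_of_outEdges' hout hζ) h𝓔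

end Sum

end LocRows

end Summit.Ventures.PercRepro2
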